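import Summits.MatrixMultiplication.OmegaCensus.SmallFormats.MatMul22nRankGF7Slack6SearchFacts
import Summits.MatrixMultiplication.OmegaCensus.SmallFormats.MatMul22nRankGF7Slack5SearchSem
import Summits.MatrixMultiplication.OmegaCensus.SmallFormats.MatMul22nRankGF7Slack5PatInv
import HarnessLib

/-!
# ω-census family (a): semantics of the slack-6 search checker K6 — relations in free coordinates, need keys, determined levels

Cell `pub-omega` (unit `pub-omega-tensor-g17`, landed by `pub-omega-tensor-g18`), topic `Summits/MatrixMultiplication/OmegaCensus` (sub-folder `SmallFormats`).
Framing (verbatim): lottery ticket; floor = certified bounds/negative ranges. HONEST FRAMING: kernel infrastructure — first part of the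
soundness proof of `MatMul22nRankGF7Slack6Search` (`pub-omega-tensor-g17/KERNEL-S6-DESIGN.md` §2); nothing here is progress on `ω`.

For an `x` whose tangent rows are `6` and whose row-plane rows are `12` (an LP-tight point of slack 6) with all torus columns slack-6 patterns:
* `fvec6 x` = the vector of the 73 FREE coset counts; `stateW6 x L` = its base-`2^12` packing of length `k6Base L` (the true search state);
* `relVal7_cross6` / `cross_congr6`: the functional of a cross relation = own-torus part + free-coordinate part; at `x` the own-torus part is
  `≡ c + Σ_i e_i f_i (mod 7)`; `det_coord6`: at a determined level each coset count EQUALS its residue;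
* `needKey6_eq`: `needKey6 L (stateW6 x L) = colKey6 L (column L)`; `detRes6_eq`: `detRes6 L (stateW6 x L)` is the block vector of column `L`;
  `hepOK6_pat`: the heptad test passes on (the block vector of) any slack-6 pattern; `expL6_eq`: digit expansion; `stateW6_succ`.
-/

namespace Summit.MatrixMultiplication.OmegaCensus.SmallFormats

open Finset
open Literature.NumberTheory.NumberFields (list_sum_range_map)

set_option exponentiation.threshold 100000

-- the data tables are only ever read through the `decide`-checked facts; never unfold them here
attribute [local irreducible] fidx6 crossRel6 fz6 relA6 relE6 relCL6 relD6 relCD6 ag6 exp4Tab6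

/-- Negated (mod 7) free-coordinate coefficient of a cross relation. -/
def ecoN6 (L j i : ℕ) : ℕ := (7 - ecoef6 L j i) % 7
/-- Negated (mod 7) free-coordinate coefficient of a determined-level relation. -/
def dcoN6 (L z i : ℕ) : ℕ := (7 - dcoef6 L z i) % 7
/-- The coset count at coordinate `u = 42·torus + z`, as an integer. -/
def colZ6 (x : ℕ → ℕ) (u : ℕ) : ℤ := (colN7 x (u / 42) (u % 42) : ℤ)

/-! ## The true free vector and states -/

/-- The free coset counts of `x` in the global free-coordinate numbering. -/
def fvec6 (x : ℕ → ℕ) (i : ℕ) : ℕ := colN7 x (torOf6 (flv6 i)) (fpt6 i)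
/-- The true search state at level `L`: the packed free counts of the levels `< L`. -/
def stateW6 (x : ℕ → ℕ) (L : ℕ) : ℕ := packW 12 (fvec6 x) (k6Base L)
/-- The key of a 42-vector `Q` at bucket level `L` (the function computed lane-wise by the main check). -/
def colKey6 (L : ℕ) (Q : ℕ → ℕ) : ℕ := ∑ j ∈ range (k6Ncr L), (∑ z ∈ range 42, acoef6 L j z * Q z) % 7 * 7 ^ j
/-- The free code of a 42-vector `Q` at level `L`: `Σ_k Q (fz6 L k) 8^k`. -/
def freeCode6 (L : ℕ) (Q : ℕ → ℕ) : ℕ := packW 3 (fun k => Q (fz6 L k)) (k6NFree L)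

/-- `lev6_ok` in plain form. -/
theorem lev6_ok' {L : ℕ} (hL : L < 21) : k6Base (L + 1) = k6Base L + k6NFree L ∧ k6Base L ≤ 73 ∧ (1 ≤ L → 18 ≤ k6Base L) ∧
    k6Ncr L ≤ 15 ∧ (k6IsBkt L = true ↔ 0 < k6Ncr L) ∧ (k6IsBkt L = true ↔ 0 < k6NFree L ∧ 1 ≤ L) ∧ k6Hid L ≤ k6Ncr L := lev6_ok ⟨L, hL⟩
/-- `torOf6` values are `< 21`. -/
theorem torOf6_lt {L : ℕ} (hL : L < 21) : torOf6 L < 21 := torOf6_ok.2.1 ⟨L, hL⟩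
/-- `free6_ok` in plain form. -/
theorem free6_ok' {i : ℕ} (hi : i < 73) : flv6 i < 21 ∧ k6Base (flv6 i) ≤ i ∧ i < k6Base (flv6 i) + k6NFree (flv6 i) ∧
    fpt6 i < 42 ∧ fcoord6 i < 882 ∧ fidx6 (fcoord6 i) = i + 1 := free6_ok ⟨i, hi⟩
/-- `fz6_glob` in plain form. -/
theorem fz6_glob' {L : ℕ} (hL : L < 21) {k : ℕ} (hk18 : k < 18) (hk : k < k6NFree L) :
    flv6 (k6Base L + k) = L ∧ fpt6 (k6Base L + k) = fz6 L k ∧ fz6 L k < 42 := fz6_glob ⟨L, hL⟩ ⟨k, hk18⟩ hk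

/-- `k6NFree L ≤ 18` (and `≤ 13` for `L ≥ 1`). -/
theorem k6NFree_le (L : ℕ) : k6NFree L ≤ 18 ∧ (1 ≤ L → k6NFree L ≤ 13) := by
  by_cases h : L < 14
  · interval_cases L <;> decide
  · have e : k6NFree L = 0 := by unfold k6NFree; rw [List.getD_eq_default]; simp; omega
    omega

/-- At a point whose torus columns are slack-6 patterns, the free counts are `≤ 6`. -/
theorem fvec6_le {x : ℕ → ℕ} (hx : ∀ j < 21, ∀ z < 42, colN7 x j z ≤ 6) {i : ℕ} (hi : i < 73) : fvec6 x i ≤ 6 := by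
  obtain ⟨hl, _, _, hp, _, _⟩ := free6_ok' hi
  exact hx _ (torOf6_lt hl) _ hp

/-- The key only depends on the 42 values. -/
theorem colKey6_congr (L : ℕ) {Q Q' : ℕ → ℕ} (h : ∀ z < 42, Q z = Q' z) : colKey6 L Q = colKey6 L Q' := by
  unfold colKey6
  exact sum_congr rfl fun j _ => by rw [sum_congr rfl fun z hz => by rw [h z (mem_range.1 hz)]]

/-- Keys are `< 2^43`. -/
theorem colKey6_lt (L : ℕ) (hL : L < 21) (Q : ℕ → ℕ) : colKey6 L Q < 2 ^ 43 := by
  unfold colKey6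
  exact sum_pow7_lt (lev6_ok' hL).2.2.2.1 fun j _ => by have := Nat.mod_lt (∑ z ∈ range 42, acoef6 L j z * Q z) (by norm_num : 0 < 7); omega

/-- The free code only depends on the 42 values. -/
theorem freeCode6_congr (L : ℕ) (hL : L < 21) {Q Q' : ℕ → ℕ} (h : ∀ z < 42, Q z = Q' z) : freeCode6 L Q = freeCode6 L Q' := by
  unfold freeCode6
  refine packW_congr 3 fun k hk => h _ ?_
  have hk18 : k < 18 := lt_of_lt_of_le hk (k6NFree_le L).1
  have h42 : fz6 L k < 42 := (fz6_glob' hL hk18 hk).2.2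
  exact h42

/-- Free codes of the levels `≥ 1` are `< 2^39`. -/
theorem freeCode6_lt {L : ℕ} (hL : L < 21) (hL1 : 1 ≤ L) {Q : ℕ → ℕ} (hQ : ∀ z < 42, Q z ≤ 6) : freeCode6 L Q < 2 ^ 39 := by
  unfold freeCode6
  have hn : k6NFree L ≤ 13 := (k6NFree_le L).2 hL1
  have hlt : packW 3 (fun k => Q (fz6 L k)) (k6NFree L) < 2 ^ (3 * k6NFree L) := packW_lt _ _ fun k hk => by
    have hk18 : k < 18 := by omega
    have h42 : fz6 L k < 42 := (fz6_glob' hL hk18 hk).2.2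
    have := hQ _ h42; show Q (fz6 L k) < 2 ^ 3; omega
  exact lt_of_lt_of_le hlt (Nat.pow_le_pow_right (by norm_num) (by omega))

/-! ## Sums over the free coordinates -/

/-- Collapsing a sum over the 882 coordinates weighted on the free coordinates `< N` to a sum over the free indices. -/
theorem sum_free6 {N : ℕ} (hN : N ≤ 73) (w : ℕ → ℕ) (Q : ℕ → ℤ) :
    ∑ u ∈ range 882, (if 0 < fidx6 u ∧ fidx6 u - 1 < N then (w (fidx6 u - 1) : ℤ) else 0) * Q u = ∑ i ∈ range N, (w i : ℤ) * Q (fcoord6 i) := by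
  set g : ℕ → ℤ := fun u => (if 0 < fidx6 u ∧ fidx6 u - 1 < N then (w (fidx6 u - 1) : ℤ) else 0) * Q u with hg
  have hfi : ∀ i < 73, fidx6 (fcoord6 i) = i + 1 := fun i hi => (free6_ok ⟨i, hi⟩).2.2.2.2.2
  have hco : ∀ i < 73, fcoord6 i < 882 := fun i hi => (free6_ok ⟨i, hi⟩).2.2.2.2.1
  have hinj : ∀ i ∈ range N, ∀ i' ∈ range N, fcoord6 i = fcoord6 i' → i = i' := by
    intro i hi i' hi' h
    have h1 := hfi i (by have := mem_range.1 hi; omega)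
    have h2 := hfi i' (by have := mem_range.1 hi'; omega)
    have : fidx6 (fcoord6 i) = fidx6 (fcoord6 i') := by rw [h]
    rw [h1, h2] at this; omega
  -- rewrite the right-hand side as a sum of g over the image
  have hrhs : ∑ i ∈ range N, (w i : ℤ) * Q (fcoord6 i) = ∑ i ∈ range N, g (fcoord6 i) := by
    refine sum_congr rfl fun i hi => ?_
    have hi' := mem_range.1 hi
    have h1 := hfi i (by omega)
    simp only [hg]
    rw [if_pos ⟨by rw [h1]; omega, by rw [h1]; simpa using hi'⟩, h1, Nat.add_sub_cancel]
  rw [hrhs, ← sum_image hinj]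
  symm
  apply sum_subset
  · intro u hu; rw [mem_image] at hu; obtain ⟨i, hi, rfl⟩ := hu
    exact mem_range.2 (hco i (by have := mem_range.1 hi; omega))
  · intro u hu hnot
    simp only [hg]
    rw [if_neg]; · simp
    rintro ⟨hpos, hlt⟩
    apply hnot
    rw [mem_image]
    refine ⟨fidx6 u - 1, mem_range.2 hlt, ?_⟩
    exact (fidx6_ok ⟨u, mem_range.1 hu⟩).2 hpos

/-- The coset count at the coordinate of a free index is the free count. -/
theorem colN7_fcoord6 (x : ℕ → ℕ) {i : ℕ} (hi : i < 73) : colN7 x (fcoord6 i / 42) (fcoord6 i % 42) = fvec6 x i := by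
  have hp : fpt6 i < 42 := (free6_ok ⟨i, hi⟩).2.2.2.1
  unfold fcoord6 fvec6
  rw [show (42 * torOf6 (flv6 i) + fpt6 i) / 42 = torOf6 (flv6 i) by omega, show (42 * torOf6 (flv6 i) + fpt6 i) % 42 = fpt6 i by omega]

/-! ## The functional of a cross relation -/

/-- Pointwise form of the cross coefficient function against a weight. -/
theorem coefCross6_mul (L j u : ℕ) (X : ℤ) : ((coefCross6 L j u : ℕ) : ℤ) * X
    = (if u / 42 = torOf6 L then (acoef6 L j (u % 42) : ℤ) else 0) * X
      + (if 0 < fidx6 u ∧ fidx6 u - 1 < k6Base L then (ecoN6 L j (fidx6 u - 1) : ℤ) else 0) * X := by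
  unfold coefCross6 ecoN6; push_cast; split_ifs <;> push_cast <;> ring

/-- Pointwise form of the determined-level coefficient function against a weight. -/
theorem coefDet6_mul (L z u : ℕ) (X : ℤ) : ((coefDet6 L z u : ℕ) : ℤ) * X
    = (if u = 42 * torOf6 L + z then (1 : ℤ) else 0) * X
      + (if 0 < fidx6 u ∧ fidx6 u - 1 < k6Base L then (dcoN6 L z (fidx6 u - 1) : ℤ) else 0) * X := by
  unfold coefDet6 dcoN6; push_cast; split_ifs <;> push_cast <;> ring

/-- `((7 − e) % 7 + e) ≡ 0 (mod 7)` for digits `e ≤ 6`. -/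
theorem neg7_add (e : ℕ) (he : e ≤ 6) : ((7 - e) % 7 + e) % 7 = 0 := by
  interval_cases e <;> decide

set_option maxHeartbeats 8000000 in
/-- **The functional of cross relation `j` of bucket level `L`** at a point `x`: own-torus part plus free-coordinate part. -/
theorem relVal7_cross6 {L : ℕ} (hL : L < 21) (j : ℕ) (x : ℕ → ℕ)
    (hfact : ∀ u : Fin 882, fld 3 (relA6 (crossRel6 L j)) u.val = coefCross6 L j u.val) :
    relVal7 (relA6 (crossRel6 L j)) x = ∑ z ∈ range 42, (acoef6 L j z : ℤ) * (colN7 x (torOf6 L) z : ℤ)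
      + ∑ i ∈ range (k6Base L), (ecoN6 L j i : ℤ) * (fvec6 x i : ℤ) := by
  have hN : k6Base L ≤ 73 := (lev6_ok' hL).2.1
  have ht : torOf6 L < 21 := torOf6_lt hL
  unfold relVal7
  have hd : ∀ u ∈ range 882, (fld 3 (relA6 (crossRel6 L j)) u : ℤ) * xrs7 x (cosetRow7 (u / 42) (u % 42))
      = (if u / 42 = torOf6 L then (acoef6 L j (u % 42) : ℤ) else 0) * colZ6 x u
        + (if 0 < fidx6 u ∧ fidx6 u - 1 < k6Base L then (ecoN6 L j (fidx6 u - 1) : ℤ) else 0) * colZ6 x u := by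
    intro u hu
    have e : fld 3 (relA6 (crossRel6 L j)) u = coefCross6 L j u := hfact ⟨u, mem_range.1 hu⟩
    rw [e, show xrs7 x (cosetRow7 (u / 42) (u % 42)) = colZ6 x u from by unfold colZ6; rw [colN7_cast]]; exact coefCross6_mul L j u _
  rw [sum_congr rfl hd, sum_add_distrib, sum_place42 _ ht (acoef6 L j) (colZ6 x), sum_free6 hN (ecoN6 L j) (colZ6 x)]
  have e1 : ∑ z ∈ range 42, (acoef6 L j z : ℤ) * colZ6 x (42 * torOf6 L + z) = ∑ z ∈ range 42, (acoef6 L j z : ℤ) * (colN7 x (torOf6 L) z : ℤ) := by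
    refine sum_congr rfl fun z hz => ?_
    have hz' := mem_range.1 hz
    unfold colZ6
    rw [show (42 * torOf6 L + z) / 42 = torOf6 L by omega, show (42 * torOf6 L + z) % 42 = z by omega]
  have e2 : ∑ i ∈ range (k6Base L), (ecoN6 L j i : ℤ) * colZ6 x (fcoord6 i) = ∑ i ∈ range (k6Base L), (ecoN6 L j i : ℤ) * (fvec6 x i : ℤ) := by
    refine sum_congr rfl fun i hi => ?_
    have hi' := mem_range.1 hi
    unfold colZ6
    rw [colN7_fcoord6 x (by omega)]
  rw [e1, e2]

/-- **Congruence of a cross relation at an LP-tight point of slack 6**: the own-torus part is `≡ constant + free part (mod 7)`. -/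
theorem cross_congr6 {L : ℕ} (hL : L < 21) (j : ℕ) (x : ℕ → ℕ)
    (hT : ∀ t < 384, xrs7 x t = 6) (hR : ∀ k < 8, xrs7 x (1266 + k) = 2 * (6 : ℤ))
    (hfact : ∀ u : Fin 882, fld 3 (relA6 (crossRel6 L j)) u.val = coefCross6 L j u.val) (hr : crossRel6 L j < 785)
    (hc : ccoef6 L j = relC6 (crossRel6 L j)) (he : ∀ i < k6Base L, ecoef6 L j i ≤ 6) :
    (∑ z ∈ range 42, acoef6 L j z * colN7 x (torOf6 L) z) % 7 = (ccoef6 L j + ∑ i ∈ range (k6Base L), ecoef6 L j i * fvec6 x i) % 7 := by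
  obtain ⟨hok, hconst⟩ := relOK6 hr
  have h := rel7_of_relOK7 hok 6 x (fun t ht => by exact_mod_cast hT t ht) hR
  rw [relVal7_cross6 hL j x hfact, ← relConstL7_eq] at h
  have h2 : (((∑ z ∈ range 42, acoef6 L j z * colN7 x (torOf6 L) z + ∑ i ∈ range (k6Base L), ecoN6 L j i * fvec6 x i : ℕ) : ℤ)) % 7
      = (((6 * relConstL7 (relW6 (crossRel6 L j))) % 7 : ℕ) : ℤ) := by
    push_cast at h ⊢; rw [h]
  rw [← hconst] at h2
  have h3 : (∑ z ∈ range 42, acoef6 L j z * colN7 x (torOf6 L) z + ∑ i ∈ range (k6Base L), ecoN6 L j i * fvec6 x i) % 7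
      = relC6 (crossRel6 L j) := by omega
  have h12 : (∑ i ∈ range (k6Base L), ecoN6 L j i * fvec6 x i + ∑ i ∈ range (k6Base L), ecoef6 L j i * fvec6 x i) % 7 = 0 := by
    have hz : ∀ i ∈ range (k6Base L), (ecoN6 L j i * fvec6 x i + ecoef6 L j i * fvec6 x i) % 7 = 0 := by
      intro i hi
      unfold ecoN6; rw [← add_mul, Nat.mul_mod, neg7_add _ (he i (mem_range.1 hi))]; simp
    rw [← sum_add_distrib, Finset.sum_nat_mod, sum_eq_zero hz, Nat.zero_mod]
  rw [hc, ← h3]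
  omega

/-! ## The need key -/

/-- **Generic need computation.** Blocks of dot products plus constants, reduced mod 7, gathered in base 7. -/
theorem needKey_generic {f : ℕ → ℕ} {N n : ℕ} (hN : 0 < N) (hN73 : N ≤ 73) (hn : 0 < n) (hn15 : n ≤ 15) (hf : ∀ i < N, f i ≤ 6)
    {e : ℕ → ℕ → ℕ} (he : ∀ j < n, ∀ i < N, e j i ≤ 6) {c : ℕ → ℕ} (hc : ∀ j < n, c j < 7) (E C V : ℕ)
    (hE : E = packW 1752 (fun j => packW 12 (fun k => e j (N - 1 - k)) N) n) (hC : C = packW 1752 c n)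
    (hVdef : V = (((packW 12 f N * E) >>> (12 * (N - 1))) &&& laneMask12 n) + C) :
    (((V - 7 * (((V * 18725) >>> 17) &&& laneMask12 n)) * ((List.range n).map fun j => 7 ^ j * 2 ^ (1752 * (n - 1 - j))).sum)
        >>> (1752 * (n - 1))) % 2 ^ 43 = ∑ j ∈ range n, (c j + ∑ i ∈ range N, f i * e j i) % 7 * 7 ^ j := by
  have hV : V = packW 1752 (fun j => ∑ i ∈ range N, f i * e j i + c j) n := by
    rw [hVdef, hE, hC, blocks_dot hN hN73 hf he, ← packW_add]
  have hv : ∀ j < n, (fun j => ∑ i ∈ range N, f i * e j i + c j) j < 2 ^ 14 := by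
    intro j hj
    show ∑ i ∈ range N, f i * e j i + c j < 2 ^ 14
    calc ∑ i ∈ range N, f i * e j i + c j ≤ ∑ i ∈ range N, 6 * 6 + 7 :=
          Nat.add_le_add (sum_le_sum fun i hi => Nat.mul_le_mul (hf i (mem_range.1 hi)) (he j hj i (mem_range.1 hi))) (hc j hj).le
      _ ≤ 73 * (6 * 6) + 7 := by simp only [sum_const, card_range, smul_eq_mul]; nlinarith
      _ < 2 ^ 14 := by norm_num
  rw [hV, blocks_resid hv,
    blocks_gather7 hn hn15 (fun j _ => by have := Nat.mod_lt ((fun j => ∑ i ∈ range N, f i * e j i + c j) j) (by norm_num : 0 < 7); omega)]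
  exact sum_congr rfl fun j _ => by rw [add_comm (c j)]

set_option maxRecDepth 20000 in
set_option maxHeartbeats 4000000 in
/-- **`needKey6` computes the key of the true column** at an LP-tight point of slack 6 whose columns are slack-6 patterns. -/
theorem needKey6_eq {L : ℕ} (hL : L < 21) (hB : k6IsBkt L = true) (x : ℕ → ℕ) (hx : ∀ j < 21, ∀ z < 42, colN7 x j z ≤ 6)
    (hT : ∀ t < 384, xrs7 x t = 6) (hR : ∀ k < 8, xrs7 x (1266 + k) = 2 * (6 : ℤ))
    (hfacts : ∀ j < k6Ncr L, levStart6 L ≤ crossRel6 L j ∧ crossRel6 L j < levStart6 (L + 1) ∧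
      (∀ u : Fin 882, fld 3 (relA6 (crossRel6 L j)) u.val = coefCross6 L j u.val) ∧ ccoef6 L j = relC6 (crossRel6 L j) ∧
      (∀ z < 42, acoef6 L j z ≤ 6) ∧ (∀ i < k6Base L, ecoef6 L j i ≤ 6))
    (hshape : relE6 L = packW 1752 (fun j => packW 12 (fun k => ecoef6 L j (k6Base L - 1 - k)) (k6Base L)) (k6Ncr L) ∧
      relCL6 L = packW 1752 (ccoef6 L) (k6Ncr L)) (hls : levStart6 (L + 1) ≤ 785) :
    needKey6 L (stateW6 x L) = colKey6 L (colN7 x (torOf6 L)) := by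
  obtain ⟨_, hN73, h18, hncr, hbk, hbk2, _⟩ := lev6_ok' hL
  have hncr0 : 0 < k6Ncr L := hbk.1 hB
  have hL1 : 1 ≤ L := (hbk2.1 hB).2
  have hN0 : 0 < k6Base L := by have := h18 hL1; omega
  have hf : ∀ i < k6Base L, fvec6 x i ≤ 6 := fun i hi => fvec6_le hx (by omega)
  have hr785 : ∀ j < k6Ncr L, crossRel6 L j < 785 := fun j hj => by have := (hfacts j hj).2.1; omega
  have hc7 : ∀ j < k6Ncr L, ccoef6 L j < 7 := fun j hj => by
    rw [(hfacts j hj).2.2.2.1, (relOK6 (hr785 j hj)).2]; exact Nat.mod_lt _ (by norm_num)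
  have key := needKey_generic hN0 hN73 hncr0 hncr hf (fun j hj i hi => (hfacts j hj).2.2.2.2.2 i hi) hc7 (relE6 L) (relCL6 L)
    (needV6 L (stateW6 x L)) hshape.1 hshape.2 rfl
  have e1 : needKey6 L (stateW6 x L) = (((needV6 L (stateW6 x L) - 7 * (((needV6 L (stateW6 x L) * 18725) >>> 17) &&& laneMask12 (k6Ncr L)))
      * ((List.range (k6Ncr L)).map fun j => 7 ^ j * 2 ^ (1752 * (k6Ncr L - 1 - j))).sum) >>> (1752 * (k6Ncr L - 1))) % 2 ^ 43 := rfl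
  rw [e1, key]
  unfold colKey6
  refine sum_congr rfl fun j hj => ?_
  have hj' := mem_range.1 hj
  obtain ⟨_, _, hfact, hc, _, hec⟩ := hfacts j hj'
  rw [cross_congr6 hL j x hT hR hfact (hr785 j hj') hc hec]
  exact congrArg (· * 7 ^ j) (congrArg (· % 7) (congrArg (ccoef6 L j + ·) (sum_congr rfl fun i _ => mul_comm _ _)))

end Summit.MatrixMultiplication.OmegaCensus.SmallFormats
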